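/-
Copyright (c) 2026. Released under Apache 2.0 license as described in the file LICENSE.
-/
import Summits.RiemannHypothesis.RiemannHypothesis.Theorems.LiDirichletKernelProgCoeffs
import Summits.RiemannHypothesis.RiemannHypothesis.Theorems.LiKernelTable
import Summits.RiemannHypothesis.RiemannHypothesis.Theorems.LiDirichletTrendDefs
import HarnessLib

/-!
# KERNEL LINEAGE K-χ — soundness II: the Taylor side (`ℓ_i(χ)`, `Re q_j(χ)`, `lt_χ(n)`)

RH-FREE DATA machinery.  bears_on: LADDER-RH L-D (Dirichlet rows).  WHAT THIS IS NOT: nothing here bears on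
the truth of RH or GRH.

* `charVals_spec` — the boxes of the character values `e(t/d)` (`MC.expI`);
* `ellList_spec` — `ellList` encloses `ℓ_i(χ) = L^{(i)}(1,χ)/i!` (`DirichletLTaylor.lTaylorCoeff`): the
  character sum of the per-residue coefficient lists is `[w^{i+1}]P_χ` (`emMainOneCharCoeff_eq_sum`, residues off
  the unit list contribute `χ(m) = 0`), and the Cauchy radii are those of
  `DirichletLTaylor.norm_lTaylorCoeff_sub_le`;
* `qListC_spec` — Keiper's recursion with one complex division by `ℓ_0 = L(1,χ) ≠ 0`
  (`DirichletLTaylor.sum_lTaylorCoeff_mul_logDerivCoeff`) encloses `Re q_j(χ)`;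
* `encl_oscRows` — `LiKernel.oscSeq` then encloses the arithmetic part `lt_χ(n) = charLiOsc χ n`
  (`Theorems/LiDirichletTrendDefs.lean`; `charLogDerivCoeff = DirichletLTaylor.logDerivCoeff` by `rfl`).
-/

set_option linter.dupNamespace false

namespace Summit.RiemannHypothesis.RiemannHypothesis.Theorems.LiDirichletKernel

open Literature.Analysis.ValidatedNumerics Literature.Analysis.ValidatedNumerics.NumericsMP
open Literature.NumberTheory.LFunctions Literature.NumberTheory.LFunctions.Xiao2020
open Literature.NumberTheory.LFunctions.Xiao2020.CertKernel
open Literature.NumberTheory.LFunctions.DirichletLTaylor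
open Summit.RiemannHypothesis.RiemannHypothesis.Theorems.LiKernel
open Summit.RiemannHypothesis.RiemannHypothesis.Theorems.LiTheory
open Finset Complex
open scoped Nat

variable {S : ℕ}

/-! ## Character values -/

/-- The root of unity `e(t/d) = exp(2πi t/d)`. -/
noncomputable def rootOfUnity (d t : ℕ) : ℂ := Complex.exp (2 * Real.pi * Complex.I * ((t : ℂ) / d))

/-- `charValBox` encloses `e(t/d)`. -/
theorem charValBox_spec (hS : 0 < S) {Kexp kexp : ℕ} {piI : MI} (hpi : MI.mem S Real.pi piI) {d t : ℕ}
    (hd : 0 < d) {V : MC} (h : charValBox S Kexp kexp piI d t = some V) : MC.mem S (rootOfUnity d t) V := by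
  unfold charValBox at h
  have hθ : MI.mem S (Real.pi * (2 : ℤ) * (t : ℤ) / d) (((piI.mulInt 2).mulInt (t : ℤ)).divNat d) :=
    MI.mem_divNat (MI.mem_mulInt (MI.mem_mulInt hpi 2) (t : ℤ)) hd
  have := MC.mem_expI hS hpi h hθ
  refine (show rootOfUnity d t = _ from ?_) ▸ this
  rw [rootOfUnity]
  congr 1
  push_cast
  ring

/-- `charVals` encloses `k ↦ e(t_k/d)` along the exponent list, with the same length. -/
theorem charVals_spec (hS : 0 < S) {Kexp kexp : ℕ} {piI : MI} (hpi : MI.mem S Real.pi piI) {d : ℕ} (hd : 0 < d) :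
    ∀ (ts : List ℕ) (V : List MC), charVals S Kexp kexp piI d ts = some V →
      V.length = ts.length ∧ EnclC S (fun k ↦ rootOfUnity d (ts.getD k 0)) V
  | [], V, h => by
    simp only [charVals, Option.some.injEq] at h
    subst h; exact ⟨rfl, trivial⟩
  | t :: ts, V, h => by
    simp only [charVals] at h
    split at h
    · rename_i v vs hv hvs
      simp only [Option.some.injEq] at h
      subst h
      obtain ⟨hl, he⟩ := charVals_spec hS hpi hd ts vs hvs
      exact ⟨by simp [hl], by simpa using charValBox_spec hS hpi hd hv, he.congr' fun k ↦ by simp⟩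
    · simp at h

/-! ## The character sum of the per-residue coefficient lists -/

/-- Length of `combPass`. -/
theorem length_combPass (S : ℕ) : ∀ (V : List MC) (Cs : List (List MI)) (acc : List MC),
    (∀ k < Cs.length, (Cs.getD k []).length = acc.length) → (combPass S V Cs acc).length = acc.length
  | [], _, _, _ => by simp [combPass]
  | _ :: _, [], _, _ => by simp [combPass]
  | V :: Vs, C :: Cs, acc, h => by
    simp only [combPass]
    have hC : C.length = acc.length := by simpa using h 0 (by simp)
    rw [length_combPass S Vs Cs _ (fun k hk ↦ by simpa [hC] using h (k + 1) (by simpa using hk))]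
    simp [hC]

/-- `combPass` adds `Σ_k v_k · f_k` entrywise. -/
theorem enclC_combPass (hS : 0 < S) {v : ℕ → ℂ} {f : ℕ → ℕ → ℝ} :
    ∀ (V : List MC) (Cs : List (List MI)) (acc : List MC) (g : ℕ → ℂ),
      EnclC S v V → (∀ k < Cs.length, Encl S (f k) (Cs.getD k [])) → EnclC S g acc →
      EnclC S (fun i ↦ g i + ∑ k ∈ range (min V.length Cs.length), v k * f k i) (combPass S V Cs acc)
  | [], _, _, _, _, _, hacc => by simpa [combPass] using hacc
  | _ :: _, [], _, _, _, _, hacc => by simpa [combPass] using hacc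
  | V :: Vs, C :: Cs, acc, g, hV, hCs, hacc => by
    simp only [combPass, List.length_cons, Nat.succ_min_succ]
    have hC : Encl S (f 0) C := by simpa using hCs 0 (by simp)
    have hrow : EnclC S (fun i ↦ v 0 * f 0 i) (C.map fun c ↦ MC.mulMI S V c) := enclC_map_mulMI hS hV.1 hC
    have := enclC_combPass hS Vs Cs (addLC acc (C.map fun c ↦ MC.mulMI S V c)) (fun i ↦ g i + v 0 * f 0 i)
      hV.2 (fun k hk ↦ by simpa using hCs (k + 1) (by simpa using hk)) (enclC_addLC hacc hrow)
    refine this.congr' fun i ↦ ?_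
    rw [sum_range_succ', add_assoc, add_comm (v 0 * f 0 i)]

/-- A sum over `ms.toFinset` as a sum over positions (`ms` without duplicates). -/
theorem sum_toFinset_eq_sum_range {ms : List ℕ} (hnd : ms.Nodup) (F : ℕ → ℂ) :
    ∑ m ∈ ms.toFinset, F m = ∑ k ∈ range ms.length, F (ms.getD k 0) := by
  induction ms with
  | nil => simp
  | cons a l ih =>
    rw [List.nodup_cons] at hnd
    rw [List.toFinset_cons, sum_insert (fun h ↦ hnd.1 (List.mem_toFinset.1 h)), ih hnd.2, List.length_cons,
      sum_range_succ']
    simp [add_comm]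

variable {q : ℕ} [NeZero q] {χ : DirichletCharacter ℂ q}

omit [NeZero q] in
/-- **The character sum**: if `χ` vanishes off the residue list `ms ⊆ [0, q)` (no duplicates), then
`[wⁱ]P_χ = Σ_k χ(ms_k) · [wⁱ]P_{ms_k}`. -/
theorem emMainOneCharCoeff_eq_sum {ms : List ℕ} (hnd : ms.Nodup) (hms : ∀ m ∈ ms, m < q)
    (hzero : ∀ m < q, m ∉ ms → χ (m : ZMod q) = 0) (N ν i : ℕ) :
    emMainOneCharCoeff N ν χ i =
      ∑ k ∈ range ms.length, χ ((ms.getD k 0 : ℕ) : ZMod q) * (progCoeffR q (ms.getD k 0) N ν i : ℂ) := by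
  rw [emMainOneCharCoeff, ← sum_toFinset_eq_sum_range hnd
    (fun m ↦ χ ((m : ℕ) : ZMod q) * (progCoeffR q m N ν i : ℂ))]
  have hsub : ms.toFinset ⊆ range q := fun m hm ↦ mem_range.2 (hms m (List.mem_toFinset.1 hm))
  rw [← sum_subset hsub (fun m hm hm' ↦ by
    rw [hzero m (mem_range.1 hm) (fun h ↦ hm' (List.mem_toFinset.2 h)), zero_mul])]
  exact sum_congr rfl fun m _ ↦ by rw [emMainOneProgCoeff_eq_ofReal]

/-! ## `ellList`: boxes of `ℓ_i(χ)` -/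

/-- **What `ellList` computes**: boxes of `ℓ_i(χ) = L^{(i)}(1,χ)/i!`, `i < len`, for `χ ≠ 1` vanishing off the unit
residue list `ms`, from boxes `V_k ∋ χ(ms_k)` and coefficient lists `Cs_k ∋ [w^·]P_{ms_k}` of length `len + 1`,
widened by the Cauchy radii `q·B/rⁱ` (`B = emTailBound N ν r`, `0 < r < 1`). -/
theorem ellList_spec (hS : 0 < S) (hχ : χ ≠ 1) {N ν len : ℕ} (hN : 1 ≤ N) (hν : ν ≠ 0) {r : ℚ}
    (hr0 : 0 < r) (hr1 : r < 1) {ms : List ℕ} (hnd : ms.Nodup) (hms : ∀ m ∈ ms, m < q)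
    (hzero : ∀ m < q, m ∉ ms → χ (m : ZMod q) = 0) {V : List MC}
    (hV : EnclC S (fun k ↦ χ ((ms.getD k 0 : ℕ) : ZMod q)) V) (hVl : V.length = ms.length)
    {Cs : List (List MI)} (hCs : ∀ k < ms.length, Encl S (progCoeffR q (ms.getD k 0) N ν) (Cs.getD k []))
    (hCsl : Cs.length = ms.length) (hCl : ∀ k < ms.length, (Cs.getD k []).length = len + 1) :
    (ellList S len V Cs (q * tailBoundQ N ν r) r⁻¹).length = len ∧
      EnclC S (lTaylorCoeff χ) (ellList S len V Cs (q * tailBoundQ N ν r) r⁻¹) := by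
  have hP := enclC_combPass hS V Cs (List.replicate (len + 1) zeroC) (fun _ ↦ (0 : ℂ)) hV
    (fun k hk ↦ hCs k (by omega)) (enclC_replicate_zeroC S (len + 1))
  have hPl := length_combPass S V Cs (List.replicate (len + 1) zeroC)
    (fun k hk ↦ by rw [hCl k (by omega)]; simp)
  rw [List.length_replicate] at hPl
  have hP' : EnclC S (emMainOneCharCoeff N ν χ) (combPass S V Cs (List.replicate (len + 1) zeroC)) := by
    refine hP.congr' fun i ↦ ?_
    rw [zero_add, hVl, hCsl, min_self, emMainOneCharCoeff_eq_sum hnd hms hzero]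
  refine ⟨by simp [ellList, hPl], ?_⟩
  refine enclC_widenPassC S _ (fun i ↦ emMainOneCharCoeff N ν χ (i + 1)) _ _ _ (enclC_tail hP') ?_
  intro i _
  have hb := norm_lTaylorCoeff_sub_le hχ hN hν (r := (r : ℝ)) (by exact_mod_cast hr0) (by exact_mod_cast hr1) i
  refine hb.trans_eq ?_
  rw [Rat.cast_mul, Rat.cast_mul, tailBoundQ_cast, Rat.cast_pow, Rat.cast_inv, Rat.cast_natCast, inv_pow,
    pow_succ]
  have hr : (r : ℝ) ≠ 0 := by exact_mod_cast hr0.ne'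
  field_simp

/-! ## `qListC`: boxes of `Re q_j(χ)` -/

/-- Keiper's recursion solved for `q_m`: `q_m = ((m+1)ℓ_{m+1} − Σ_{i<m} ℓ_{i+1} q_{m−1−i}) / ℓ_0`. -/
theorem logDerivCoeff_rec (hχ : χ ≠ 1) (m : ℕ) :
    logDerivCoeff χ m = (((m : ℂ) + 1) * lTaylorCoeff χ (m + 1) -
      ∑ i ∈ range m, lTaylorCoeff χ (i + 1) * logDerivCoeff χ (m - 1 - i)) * (lTaylorCoeff χ 0)⁻¹ := by
  have h := sum_lTaylorCoeff_mul_logDerivCoeff hχ m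
  rw [sum_range_succ', Nat.sub_zero] at h
  have h0 : lTaylorCoeff χ 0 ≠ 0 := by
    rw [lTaylorCoeff_zero]; exact DirichletCharacter.LFunction_apply_one_ne_zero hχ
  have : lTaylorCoeff χ 0 * logDerivCoeff χ m = ((m : ℂ) + 1) * lTaylorCoeff χ (m + 1) -
      ∑ i ∈ range m, lTaylorCoeff χ (i + 1) * logDerivCoeff χ (m - 1 - i) := by
    rw [← h]
    have : ∀ i ∈ range m, lTaylorCoeff χ (i + 1) * logDerivCoeff χ (m - (i + 1)) =
        lTaylorCoeff χ (i + 1) * logDerivCoeff χ (m - 1 - i) := fun i _ ↦ by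
      rw [show m - (i + 1) = m - 1 - i by omega]
    rw [sum_congr rfl this]
    ring
  field_simp
  rw [mul_comm, this]

/-- What `qPassC` computes (mirror of `Xiao2020.CertKernel.qPass_spec` with one complex division). -/
theorem qPassC_spec (hS : 0 < S) {ℓ qf : ℕ → ℂ} {w : ℂ} {W : MC} (hW : MC.mem S w W)
    (hrec : ∀ m, qf m = ((m + 1) * ℓ (m + 1) - ∑ i ∈ range m, ℓ (i + 1) * qf (m - 1 - i)) * w)
    {us : List MC} (hus : EnclC S (fun i ↦ ℓ (i + 1)) us) :
    ∀ (c : ℕ) (rest : List MC) (m : ℕ) (qrev : List MC),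
      EnclC S (fun i ↦ ℓ (m + 1 + i)) rest → c ≤ rest.length → m + c ≤ us.length →
      qrev.length = m → EnclC S (fun l ↦ qf (m - 1 - l)) qrev →
      (qPassC S W us rest m qrev c).length = m + c ∧
        EnclC S (fun l ↦ qf (m + c - 1 - l)) (qPassC S W us rest m qrev c)
  | 0, rest, m, qrev, _, _, _, hlen, hq => by
    cases rest <;> exact ⟨by simpa [qPassC] using hlen, by simpa [qPassC] using hq⟩
  | c + 1, [], m, qrev, _, hc, _, _, _ => by simp at hc
  | c + 1, u :: rest, m, qrev, hrest, hc, hm, hlen, hq => by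
    simp only [qPassC]
    have hQ : MC.mem S (qf m) (MC.mul S ((u.mulInt ((m : ℤ) + 1)).sub (dotC S us qrev)) W) := by
      have h1 : MC.mem S (ℓ (m + 1) * (((m : ℤ) + 1 : ℤ) : ℂ)) (u.mulInt ((m : ℤ) + 1)) :=
        MC.mem_mulInt (by simpa using hrest.1) _
      have h2 := mem_dotC hS hus hq
      rw [hlen, min_eq_right (by omega)] at h2
      have := MC.mem_mul hS (MC.mem_sub h1 h2) hW
      convert this using 1
      rw [hrec m]; push_cast; ring
    have hq' : EnclC S (fun l ↦ qf (m + 1 - 1 - l)) (_ :: qrev) :=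
      ⟨by simpa using hQ, hq.congr' fun l ↦ by
        show qf (m - 1 - l) = qf (m + 1 - 1 - (l + 1))
        rw [show m + 1 - 1 - (l + 1) = m - 1 - l by omega]⟩
    have := qPassC_spec hS hW hrec hus c rest (m + 1) _
      (hrest.2.congr' fun i ↦ by
        show ℓ (m + 1 + (i + 1)) = ℓ (m + 1 + 1 + i)
        rw [show m + 1 + (i + 1) = m + 1 + 1 + i by omega])
      (by simpa using hc) (show m + 1 + c ≤ us.length by omega) (by simp [hlen]) hq'
    refine ⟨by rw [this.1]; omega, this.2.congr' fun l ↦ ?_⟩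
    show qf (m + 1 + c - 1 - l) = qf (m + (c + 1) - 1 - l)
    rw [show m + 1 + c - 1 - l = m + (c + 1) - 1 - l by omega]

/-- **What `qListC` computes**: boxes of `Re q_j(χ) = Re (L′/L)^{(j)}(1,χ)/j!`, `j < c`, from boxes of
`ℓ_0, …, ℓ_c` (`χ ≠ 1`, so `ℓ_0 = L(1,χ) ≠ 0`; the program refuses unless the box of `ℓ_0` excludes `0`). -/
theorem qListC_spec (hS : 0 < S) (hχ : χ ≠ 1) {U : List MC} (hU : EnclC S (lTaylorCoeff χ) U) {c : ℕ}
    (hc : c + 1 ≤ U.length) {Q : List MI} (h : qListC S U c = some Q) :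
    Q.length = c ∧ Encl S (fun j ↦ (logDerivCoeff χ j).re) Q := by
  unfold qListC at h
  split at h
  · rename_i W hW
    simp only [Option.some.injEq] at h
    subst h
    have hW' : MC.mem S ((1 : ℂ) / lTaylorCoeff χ 0) W := by
      have h0 : MC.mem S (lTaylorCoeff χ 0) (U.getD 0 zeroC) := hU.getD (by omega)
      have := MC.mem_divBox hS hW (by simpa using MC.mem_ofInt S 1) h0
      simpa using this
    have htail : EnclC S (fun i ↦ lTaylorCoeff χ (i + 1)) U.tail := enclC_tail hU
    have htl : U.tail.length = U.length - 1 := by simp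
    obtain ⟨hl, he⟩ := qPassC_spec hS hW' (ℓ := lTaylorCoeff χ) (qf := logDerivCoeff χ)
      (fun m ↦ by rw [logDerivCoeff_rec hχ m, one_div]) htail c U.tail 0 []
      (htail.congr' fun i ↦ by
        show lTaylorCoeff χ (i + 1) = lTaylorCoeff χ (0 + 1 + i); rw [Nat.zero_add, Nat.add_comm])
      (by omega) (by omega) rfl trivial
    refine ⟨by simp [hl], ?_⟩
    have hrev := enclC_reverse he
    rw [hl] at hrev
    refine (encl_map_re (hrev.congr fun i hi ↦ ?_))
    rw [List.length_reverse, hl] at hi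
    show logDerivCoeff χ (0 + c - 1 - (0 + c - 1 - i)) = logDerivCoeff χ i
    rw [show 0 + c - 1 - (0 + c - 1 - i) = i by omega]
  · simp at h

/-! ## The arithmetic part `lt_χ(n) = charLiOsc χ n` -/

omit [NeZero q] in
/-- The route vocabulary's `charLogDerivCoeff` is `DirichletLTaylor.logDerivCoeff`. -/
theorem charLogDerivCoeff_eq [NeZero q] (χ : DirichletCharacter ℂ q) (j : ℕ) :
    charLogDerivCoeff χ j = logDerivCoeff χ j := rfl

/-- `charLiOsc χ n` with the sum extended to `len ≥ n` terms (the extra binomials vanish). -/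
theorem charLiOsc_eq_sum_range (χ : DirichletCharacter ℂ q) {n len : ℕ} (hn : n ≤ len) :
    charLiOsc χ n = ∑ i ∈ range len, ((n.choose (i + 1) : ℕ) : ℝ) * (logDerivCoeff χ i).re := by
  rw [charLiOsc, ← sum_subset (range_subset_range.2 hn) (fun i _ hi ↦ by
    rw [mem_range, not_lt] at hi
    rw [Nat.choose_eq_zero_of_lt (by omega), Nat.cast_zero, zero_mul])]
  rfl

/-- **The `lt`-rows**: from boxes `Q ∋ Re q_j`, `j < len`, `LiKernel.oscSeq` with the binomial row of `n = 1`
encloses `j ↦ lt_χ(1 + j)` for `1 + j ≤ len`. -/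
theorem encl_oscRows (χ : DirichletCharacter ℂ q) {Q : List MI} {len : ℕ}
    (hQ : Encl S (fun j ↦ (logDerivCoeff χ j).re) Q) (hQl : Q.length = len) {c : ℕ} (hc : c ≤ len) :
    Encl S (fun j ↦ charLiOsc χ (1 + j)) (oscSeq Q (pascalNext (1 :: List.replicate len 0)) c) := by
  have hR : RowIs (Nat.choose 1) (len + 1) (pascalNext (1 :: List.replicate len 0)) :=
    rowIs_pascalNext (rowIs_row0 len)
  have h := encl_oscSeq hQ hQl c 1 _ hR
  refine h.congr fun j hj ↦ ?_
  rw [length_oscSeq] at hj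
  rw [charLiOsc_eq_sum_range χ (show 1 + j ≤ len by omega)]

end Summit.RiemannHypothesis.RiemannHypothesis.Theorems.LiDirichletKernel
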